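import Summits.QuantumFields.BalabanUV.T4Continuum.Support.CTAveragingSummandHbd

/-!
# T⁴ programme, spine node NE2 (U1a), sub-row Δ3 «NE2-WALK» (T4-DAG `T4-U1a.S-NE2-D3-WALK°`) — THE CONJUGATED (H-bd) OF BAŁABAN's TYPED
# PERTURBATION `P_B = (Δ^R − Δ^1⊗1) + a·n^d(Q(R)ᴴQ(R) − QᴴQ⊗1) + P₄` MODULO THE GAUGE SLOT, and ROOT B's decay stations with the binder
# `hdec` REDUCED to the `U = 1` conjugation defect `hJ` and the gauge slot's conjugated bound `hP₄`

NE2 formalisation swarm `b2b-balaban-t4-ne2-formalise-*`, leaf prover 06 (gen 3), supplier item «Δ3-CT-HBD-B3», file D2 (assembly; file D1 =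
`Support/CTAveragingSummandHbd`; «Δ3-CT» p220700∕p220892, «Δ3-CT-HBD» p221704∕p221931; owner ruling R21 (c), INTENT CLAIMS.log l.15494).
`NE2BalabanRoot.balabanPert R P₄ = tierBPert R (avgPert R) P₄ = covPertC R + avgPert R + P₄` — rows B2 + B3 + the gauge slot (row B4):

 * §1 **`hPc_balabanPert_of_regular`**: on the (3.35)-class `RegularTransporters R α β` (row B5), with the `U = 1` conjugation defect
   `hJ : ∀ k y, ConjDefect (Δ_a^{(k)}) κ (rho k y) J` (`0 ≤ J < γ_D`) and a DISPLAYED conjugated relative bound `hP₄` for the gauge slot,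
   `‖c(P_B,k)·c((Δ_a^{(k)}⊗1)⁻¹)‖ ≤ κ_CT(B2) + κ_avg,CT(B3) + κ₄` at the canonical weights (`CTCovariantLaplacianDecay.hPc_covPertC_of_regular` +
   `CTAveragingSummandHbd.hPc_avgPert_of_regular` + `hP₄`); **`hdec_balabanPert_of_regular`** — the decay binder of the `P_B`-coupled colour
   tower at every coupling with `‖t‖·(κ_CT + κ_avg,CT + κ₄) < 1` (`CTKingTowerWeights.hdec_pertCovC_of_wCoercive`);
 * §2 **`balaban_final_decayStations_of_regular_of_conjDefect`** — THE OWNER's ROOT-B DECAY STATIONS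
   (`Spine/NE2BalabanDecayRate.balaban_final_decayStations_of_regular`, every binder of the END of record: `hreg`, `hNE3`, `a′`, `α ≤ η`, `β ≤ η`,
   `η ≤ etaStar`, `‖t‖ ≤ 1`) with its displayed `hdec` FED by §1 for `R := liftR Rg`, `P₄ := gaugeSlot Rg (QuT (siteT Rg)) Q1 a′`: the decay
   currency of ROOT B now rests, beyond the END of record's own binders, on `hJ` (U = 1 Combes–Thomas core — substrate VEC-6's target) and
   `hP₄` (the gauge slot's conjugated (H-bd) — the `D_R G′ D_Rᴴ` sandwich; substrate VEC's `CTScalarGreen` territory at U = 1) ONLY, at the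
   distance `distKC` and rate `κ`.

HONEST FRAMING (T4-DAG p. 1).  Bookkeeping over landed modules ([folklore]); statements OURS; MODEL level (transporters DATA, no B0); `hJ` and
`hP₄` DISPLAYED, asserted by nobody; `hNE3` (node NE3's `LocalRate`, OPEN) enters §2 through the END of record (the operator-norm rate), NOT
through the (H-bd); Δ3 NOT closed; NE2 (U1a) NOT PROVED; spine PROVED 0/9 unchanged; NOT infinite volume, NOT a mass gap, NOT the Clay problem,
NOT summit progress.  HONEST DEPENDENCY: continuum YM on T⁴ ⇐ BetaPertH ∧ nine spine estimates (0/9 proved); BetaPertH ⇐ (D1) ∧ (D4) ∧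
CAP+tail; G-an2-4 gates asym, D1 and NE2/3/4.  ABSOLUTE RULE kept; no `sorry`.
-/

noncomputable section

open scoped BigOperators ComplexConjugate Matrix Matrix.Norms.L2Operator Kronecker

namespace Summit.QuantumFields.BalabanUV.T4Continuum.CTBalabanPertHbd

open Literature.MathematicalPhysics.QuantumFieldTheory.Balaban1983to89.B5Prop11Plancherel (Cst Cst_nonneg Tor fine)
open Literature.MathematicalPhysics.QuantumFieldTheory.Balaban1983to89.B5G183RateUnitTower (lev lev_neZero)
open Literature.MathematicalPhysics.QuantumFieldTheory.Balaban1983to89.T4EtaRateMin (LocalRate)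
open Summit.QuantumFields.BalabanUV.T4Continuum
open Summit.QuantumFields.BalabanUV.T4Continuum.BalabanAveragedTowerUnit (idx one_le_lev')
open Summit.QuantumFields.BalabanUV.T4Continuum.BackgroundResolventTower
open Summit.QuantumFields.BalabanUV.T4Continuum.KingPairingPlantedLaw (calDalev CJ)
open Summit.QuantumFields.BalabanUV.T4Continuum.GramPerturbationLaw (C2gram)
open Summit.QuantumFields.BalabanUV.T4Continuum.NE2FromNE3 (bgReadings)
open Summit.QuantumFields.BalabanUV.T4Continuum.NE2ColourPerturbedLayer (pertCovC pertLimC)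
open Summit.QuantumFields.BalabanUV.T4Continuum.RegularBackgroundTower (RegularTransporters regClass betaNE3)
open Summit.QuantumFields.BalabanUV.T4Continuum.GaugeTermScalarData (QuT Q1)
open Summit.QuantumFields.BalabanUV.T4Continuum.RegularSiteTransporters (siteT)
open Summit.QuantumFields.BalabanUV.T4Continuum.NestedContourTransport (theta0)
open Summit.QuantumFields.BalabanUV.T4Continuum.NE2BalabanLayer (tierBPert)
open Summit.QuantumFields.BalabanUV.T4Continuum.NE2BalabanRoot (avgPert balabanPert)
open Summit.QuantumFields.BalabanUV.T4Continuum.NE2BalabanGauge (gaugeSlot liftR)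
open Summit.QuantumFields.BalabanUV.T4Continuum.NE2BalabanLayerSharp (kappaBs C2Bs)
open Summit.QuantumFields.BalabanUV.T4Continuum.NE2BalabanWiring (epsR CdeltaR)
open Summit.QuantumFields.BalabanUV.T4Continuum.NE2BalabanFinal (kappa4F C4F)
open Summit.QuantumFields.BalabanUV.T4Continuum.NE2BalabanThreshold (etaStar)
open Summit.QuantumFields.BalabanUV.T4Continuum.NE2BalabanDecayRate (balaban_final_decayStations_of_regular)
open Summit.QuantumFields.BalabanUV.T4Continuum.DecayRateInterpolation (EntryDecay DecayRate TwoLevelDecayRate)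
open Summit.QuantumFields.BalabanUV.T4Continuum.ColourCovariantLaplacian (covPertC)
open Summit.QuantumFields.BalabanUV.T4Continuum.CTWeightedCoercivity
open Summit.QuantumFields.BalabanUV.T4Continuum.CTConjugatedHbd (wCoercive_calDa_of_conjDefect)
open Summit.QuantumFields.BalabanUV.T4Continuum.CTKingTowerWeights (rho distKC hdec_pertCovC_of_wCoercive)
open Summit.QuantumFields.BalabanUV.T4Continuum.CTCovariantLaplacianDecay (kappaColCT hPc_covPertC_of_regular)
open Summit.QuantumFields.BalabanUV.T4Continuum.CTAveragingSummandHbd (kappaAvgCT hPc_avgPert_of_regular)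
open Summit.QuantumFields.BalabanUV.T4Continuum.DirichletRegionTower (gamD gamD_pos)

variable {d : ℕ} (L : ℕ) [NeZero L] (M : Fin d → ℕ) [hM : ∀ μ, NeZero (M μ)] (a : ℝ) (ha : 0 < a)
variable {o : Type*} [Fintype o] [DecidableEq o]

/-! ## §1 The conjugated (H-bd) of `P_B` modulo the gauge slot, and the decay binder of the `P_B`-coupled tower -/

/-- **THE CONJUGATED (H-bd) OF BAŁABAN's TYPED PERTURBATION MODULO THE GAUGE SLOT**: on the (3.35)-class, with the `U = 1` conjugation defect
`hJ` and a displayed conjugated relative bound `hP₄` for `P₄`, `‖c(P_B,k)·c((Δ_a^{(k)}⊗1)⁻¹)‖ ≤ κ_CT + κ_avg,CT + κ₄`. [folklore] -/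
theorem hPc_balabanPert_of_regular {R : (k : ℕ) → Fin d → (idx L M k → Matrix o o ℂ)} {α β : ℝ} (hreg : RegularTransporters L M R α β)
    {κ J : ℝ} (hJ : ∀ (k : ℕ) (y : idx L M 0), ConjDefect (calDalev L M a ha k) κ (rho L M k y) J) (hJ0 : 0 ≤ J) (hJγ : J < gamD d a)
    {P₄ : (k : ℕ) → Matrix (idx L M k × o) (idx L M k × o) ℂ} {κ₄ : ℝ}
    (hP₄ : ∀ (k : ℕ) (y : idx L M 0 × o),
      ‖conjMat κ (fun p : idx L M k × o => rho L M k y.1 p.1) (fun p : idx L M k × o => rho L M k y.1 p.1) (P₄ k)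
        * conjMat κ (fun p : idx L M k × o => rho L M k y.1 p.1) (fun p : idx L M k × o => rho L M k y.1 p.1)
          (calDalev L M a ha k ⊗ₖ (1 : Matrix o o ℂ))⁻¹‖ ≤ κ₄)
    (k : ℕ) (y : idx L M 0 × o) :
    ‖conjMat κ (fun p : idx L M k × o => rho L M k y.1 p.1) (fun p : idx L M k × o => rho L M k y.1 p.1) (balabanPert L M a R P₄ k)
        * conjMat κ (fun p : idx L M k × o => rho L M k y.1 p.1) (fun p : idx L M k × o => rho L M k y.1 p.1)
          (calDalev L M a ha k ⊗ₖ (1 : Matrix o o ℂ))⁻¹‖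
      ≤ kappaColCT o d a α β (d * (α ^ 2 + 2 * β)) J κ + kappaAvgCT (Fintype.card o) d a α J κ + κ₄ := by
  have e : balabanPert L M a R P₄ k = covPertC L M R k + avgPert L M a R k + P₄ k := rfl
  rw [e, conjMat_add, conjMat_add, Matrix.add_mul, Matrix.add_mul]
  refine (norm_add_le _ _).trans (add_le_add ((norm_add_le _ _).trans (add_le_add ?_ ?_)) (hP₄ k y))
  · exact hPc_covPertC_of_regular L M a ha hreg hJ hJ0 hJγ k y
  · exact hPc_avgPert_of_regular L M a ha hreg hJ hJγ k y

/-- **THE DECAY BINDER OF THE `P_B`-COUPLED COLOUR TOWER FROM `hreg`, `hJ` AND THE GAUGE SLOT's `hP₄`**: for every coupling with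
`‖t‖·(κ_CT + κ_avg,CT + κ₄) < 1`, `∀ k, EntryDecay distKC (pertCovC (balabanPert R P₄) t k) ((γ_D − J)⁻¹(1 − ‖t‖K)⁻¹e^{2κ}) κ`. [folklore] -/
theorem hdec_balabanPert_of_regular {R : (k : ℕ) → Fin d → (idx L M k → Matrix o o ℂ)} {α β : ℝ} (hreg : RegularTransporters L M R α β)
    {κ J : ℝ} (hκ : 0 ≤ κ) (hJ : ∀ (k : ℕ) (y : idx L M 0), ConjDefect (calDalev L M a ha k) κ (rho L M k y) J) (hJ0 : 0 ≤ J)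
    (hJγ : J < gamD d a) {P₄ : (k : ℕ) → Matrix (idx L M k × o) (idx L M k × o) ℂ} {κ₄ : ℝ}
    (hP₄ : ∀ (k : ℕ) (y : idx L M 0 × o),
      ‖conjMat κ (fun p : idx L M k × o => rho L M k y.1 p.1) (fun p : idx L M k × o => rho L M k y.1 p.1) (P₄ k)
        * conjMat κ (fun p : idx L M k × o => rho L M k y.1 p.1) (fun p : idx L M k × o => rho L M k y.1 p.1)
          (calDalev L M a ha k ⊗ₖ (1 : Matrix o o ℂ))⁻¹‖ ≤ κ₄)
    {t : ℂ} (ht : ‖t‖ * (kappaColCT o d a α β (d * (α ^ 2 + 2 * β)) J κ + kappaAvgCT (Fintype.card o) d a α J κ + κ₄) < 1) (k : ℕ) :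
    EntryDecay (distKC L M o) (pertCovC L M a ha (balabanPert L M a R P₄) t k)
      ((gamD d a - J)⁻¹ * (1 - ‖t‖ * (kappaColCT o d a α β (d * (α ^ 2 + 2 * β)) J κ + kappaAvgCT (Fintype.card o) d a α J κ + κ₄))⁻¹
        * Real.exp (κ * 2)) κ :=
  hdec_pertCovC_of_wCoercive L M a ha hκ (sub_pos.mpr hJγ)
    (fun k y => wCoercive_calDa_of_conjDefect (lev L k) (one_le_lev' L k) M a ha (hJ k y))
    (hPc_balabanPert_of_regular L M a ha hreg hJ hJ0 hJγ hP₄) ht k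

/-! ## §2 ROOT B's decay stations with `hdec` reduced to `hJ` and the gauge slot -/

/-- **ROOT B IN THE DECAY CURRENCY, MODULO THE `U = 1` CONJUGATION DEFECT AND THE GAUGE SLOT's CONJUGATED (H-bd)** (`L ≥ 2`, `d ≥ 1`): the
owner's `balaban_final_decayStations_of_regular` — every binder of the END of record (`hreg`, `hNE3` BY NAME and OPEN, `a′ > 0`, `α, β ≤ η ≤ η⋆`,
`‖t‖ ≤ 1`) — with its displayed `hdec` FED by `hdec_balabanPert_of_regular` at `R := liftR Rg`, `P₄ := gaugeSlot Rg (QuT (siteT Rg)) Q1 a′`: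
limit entry decay `(B, κ)`, King's (4.38) shapes `(√(2B·C_B(t)/(1−L⁻¹)), κ/2, √(L⁻¹))` / `(√(2B·2C_B(t)/(1−L⁻¹)), κ/2, √(L⁻¹))`, against `distKC`,
`B = (γ_D − J)⁻¹(1 − ‖t‖K)⁻¹e^{2κ}`, `K = κ_CT + κ_avg,CT + κ₄`.  Model level; CONDITIONAL on NE3 + the (3.35)-class + the threshold + `hJ` + `hP₄`;
NE2 (U1a) is NOT proved by this. [cite: King1986, Lemma 4.5 (4.38) p.674 (shape); Balaban1985BackgroundPropagators, (3.26) p.395, Thm 3.4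
p.400 (shapes)] [folklore] -/
theorem balaban_final_decayStations_of_regular_of_conjDefect (hL : 2 ≤ L) (hd : 1 ≤ d)
    {Rg : (k : ℕ) → Fin d → (Tor (fine (lev L k) M) → Matrix o o ℂ)}
    {α β : ℝ} (hreg : RegularTransporters L M (liftR L M Rg) α β) {C : ℝ} (hC : 0 ≤ C)
    (hNE3 : LocalRate (bgReadings L M (regClass L M (liftR L M Rg))) C ((L : ℝ)⁻¹)) {a' : ℝ} (ha' : 0 < a')
    {η : ℝ} (hαη : α ≤ η) (hβη : β ≤ η) (hη : η ≤ etaStar o d a a') {t : ℂ} (ht : ‖t‖ ≤ 1)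
    {κ J : ℝ} (hκ : 0 ≤ κ) (hJ : ∀ (k : ℕ) (y : idx L M 0), ConjDefect (calDalev L M a ha k) κ (rho L M k y) J) (hJ0 : 0 ≤ J)
    (hJγ : J < gamD d a) {κ₄ : ℝ}
    (hP₄ : ∀ (k : ℕ) (y : idx L M 0 × o),
      ‖conjMat κ (fun p : idx L M k × o => rho L M k y.1 p.1) (fun p : idx L M k × o => rho L M k y.1 p.1)
          (gaugeSlot L M Rg (QuT L M o (siteT L M Rg)) (Q1 L M o) a' k)
        * conjMat κ (fun p : idx L M k × o => rho L M k y.1 p.1) (fun p : idx L M k × o => rho L M k y.1 p.1)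
          (calDalev L M a ha k ⊗ₖ (1 : Matrix o o ℂ))⁻¹‖ ≤ κ₄)
    (htK : ‖t‖ * (kappaColCT o d a α β (d * (α ^ 2 + 2 * β)) J κ + kappaAvgCT (Fintype.card o) d a α J κ + κ₄) < 1) :
    EntryDecay (distKC L M o)
        (pertLimC L M a ha (balabanPert L M a (liftR L M Rg) (gaugeSlot L M Rg (QuT L M o (siteT L M Rg)) (Q1 L M o) a')) t)
        ((gamD d a - J)⁻¹ * (1 - ‖t‖ * (kappaColCT o d a α β (d * (α ^ 2 + 2 * β)) J κ + kappaAvgCT (Fintype.card o) d a α J κ + κ₄))⁻¹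
          * Real.exp (κ * 2)) κ ∧
      DecayRate (distKC L M o)
        (pertCovC L M a ha (balabanPert L M a (liftR L M Rg) (gaugeSlot L M Rg (QuT L M o (siteT L M Rg)) (Q1 L M o) a')) t)
        (pertLimC L M a ha (balabanPert L M a (liftR L M Rg) (gaugeSlot L M Rg (QuT L M o (siteT L M Rg)) (Q1 L M o) a')) t)
        (Real.sqrt (2 * ((gamD d a - J)⁻¹
            * (1 - ‖t‖ * (kappaColCT o d a α β (d * (α ^ 2 + 2 * β)) J κ + kappaAvgCT (Fintype.card o) d a α J κ + κ₄))⁻¹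
            * Real.exp (κ * 2)) *
          (Cpert (kappaBs o d a α β (a * (epsR o d α * (2 + epsR o d α) * Cst d a)) (kappa4F d a a' α β)) (2 * d * Cst d a) (CJ d a)
              (C2Bs o d L a α β C
                (a * C2gram (Cst d a) 1 (epsR o d α) (2 * d * Cst d a) (CJ d a) (Cst d a) (CdeltaR o d a α (theta0 d α (betaNE3 o C))))
                (C4F o d L a a' α β C)) 0 t / (1 - (L : ℝ)⁻¹))))
        (κ / 2) (Real.sqrt ((L : ℝ)⁻¹)) ∧
      TwoLevelDecayRate (distKC L M o)
        (pertCovC L M a ha (balabanPert L M a (liftR L M Rg) (gaugeSlot L M Rg (QuT L M o (siteT L M Rg)) (Q1 L M o) a')) t)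
        (Real.sqrt (2 * ((gamD d a - J)⁻¹
            * (1 - ‖t‖ * (kappaColCT o d a α β (d * (α ^ 2 + 2 * β)) J κ + kappaAvgCT (Fintype.card o) d a α J κ + κ₄))⁻¹
            * Real.exp (κ * 2)) * (2 *
          Cpert (kappaBs o d a α β (a * (epsR o d α * (2 + epsR o d α) * Cst d a)) (kappa4F d a a' α β)) (2 * d * Cst d a) (CJ d a)
              (C2Bs o d L a α β C
                (a * C2gram (Cst d a) 1 (epsR o d α) (2 * d * Cst d a) (CJ d a) (Cst d a) (CdeltaR o d a α (theta0 d α (betaNE3 o C))))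
                (C4F o d L a a' α β C)) 0 t / (1 - (L : ℝ)⁻¹))))
        (κ / 2) (Real.sqrt ((L : ℝ)⁻¹)) :=
  balaban_final_decayStations_of_regular L M a ha hL hd hreg hC hNE3 ha' hαη hβη hη ht
    (hdec_balabanPert_of_regular L M a ha hreg hκ hJ hJ0 hJγ hP₄ htK)

end Summit.QuantumFields.BalabanUV.T4Continuum.CTBalabanPertHbd

end
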